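import Literature.Computability.Complexity.AdditiveRealClasses
import Literature.Computability.Complexity.AdaptiveQueries
import Literature.Computability.Complexity.BrainProtocol
import Literature.Computability.Complexity.PlumbingBricks
import HarnessLib

/-!
# The oracle-driven sign machine: `P⁰_ℝovs(A)`-membership from a driver language

Topic `Literature/Computability/Complexity`, grouping namespace `FKTransfer` (the machine side of
Fournier–Koiran, *Lower bounds are not easier over the reals: inside PH*, ICALP 2000 = LIP
RR-1999-21, Thm 3: `NP⁰_ℝovs ⊆ P⁰_ℝovs(NP)`, in the sign-oracle rendering of
`AdditiveRealClasses.lean`). The report (p. 4) dismisses the oracle machine itself — "Defining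
formally the model of 'real Turing machine with a boolean oracle' … would be tedious but completely
straightforward" — and spends its pages on WHAT the machine asks (point location, §2) and on the
final Boolean `NP` question (p. 11). This file makes that division of labour a theorem of the
rendering: there is ONE polynomial-time oracle algorithm, the **driven sign machine**
`drvAlg m P T` (parameters: three polynomials), which needs no problem-specific programming at all —

* in round `i` (= number of answers received so far) with `i < T(n)` and `P(n) ∣ i + 1` it asks the
  SIGN oracle the query formed by the last `m(n)` answer bits (a **sign round**);
* in every other round it asks the BOOLEAN oracle the whole transcript `⟨1ⁿ, answers⟩`
  (a **driver round**), and after round `T(n)` it outputs the last answer bit.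

So the Boolean oracle `A` DRIVES the computation: during the `P(n) - 1` driver rounds of a frame it
may record answers to its own `NP` questions (prefix searches are conducted this way, the oracle
answering "is there a witness extending the bits recorded so far by `1`?") and then spell out, bit
by bit, the integer affine form whose sign at the input `x` it wants to learn; the last driver round
delivers the verdict. Main results:

* `tagLang A x`, `signOracleWith_eq_ofLanguage` — the tagged oracle of `PAddRel` is the language
  oracle of `tagLang A x`, so the adaptive-reduction toolkit (`AdaptiveQueries.lean`: `adAlg`,
  `isPolyTime_adAlg`, `run_adAlg`) applies; `mem_PAddRel_of_adLang` — ANY bounded adaptive reduction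
  (`Q ∈ FP`, `D ∈ P`) whose reduced language agrees with `L` puts `L ∈ P⁰_ℝovs(A)`;
* `drvQ m P T ∈ FP` (`drvQ_mem_FP`, value `drvQ_apply`) — the query generator of the driven
  machine, assembled from the tree's bricks (`PlumbingBricks.lean`: `polyFn`, `dropFn`, `modLenFn`;
  `eqPairFn`, `iteFn`); the verdict "last answer bit is `1`" is `BrainProtocol.Verdict ∈ P`
  (`BrainProtocol.lean`);
* `drvAlg m P T = adAlg (drvQ m P T) (T + 1) BrainProtocol.Verdict` and `isPolyTime_drvAlg`.

Relation to `BrainProtocol.lean` (Fortnow–Rogers' oracle-driven `P^{K ⊕ G}` machine): the same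
idea — let one half of the oracle do the thinking — with two differences forced by `PAddRel`: here
the THINKING half sits behind the tag `1` and the probed half (the sign oracle of `x`) behind `0`
(and the empty query), the opposite of `joinLang`; and probes are raw code words of integer affine
forms, which we schedule at FIXED rounds (period `P`, payload = last `m` bits) instead of the token
framing of `BrainProtocol.talk`, so that no transducer has to parse the history.

The sequel `DrivenSignMachineStream.lean` identifies the transcript of `drvAlg` against
`signOracleWith A x` with a machine-free STREAM of the driver `[⟨1ⁿ, ·⟩ ∈ A]` and the sign
environment of `x`, and concludes `L ∈ PAddRel A` / `L ∈ PAddRelClass C` from a driver whose verdict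
is `[x ∈ L n]`; with it, Theorem 3 of the report is reduced to exhibiting a driver language `A ∈ NP`
whose driven stream locates `x` (report §2) and whose verdict is the Boolean `NP` question of
p. 11 — no further machine has to be built.

Not here: any driver (point location, the final `NP` check), `NP`-membership of drivers.

## References

* H. Fournier, P. Koiran, *Lower bounds are not easier over the reals: inside PH*, ICALP 2000,
  LNCS 1853 = LIP RR-1999-21, §2 (p. 4: the oracle model; prefix search with an `NP` oracle, §2.1),
  §3 Thm 3 (p. 11). [FournierKoiran2000]
* R. E. Ladner, N. A. Lynch, A. L. Selman, *A comparison of polynomial time reducibilities*,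
  Theoret. Comput. Sci. 1 (1975), §2 (adaptive = Turing reductions). [LadnerLynchSelman1975]
-/

namespace Literature.Computability.Complexity

namespace FKTransfer

open _root_.Computability Polynomial Brick AdQuery

/-! ### The tagged oracle is a language oracle -/

/-- The language answered by the tagged oracle `signOracleWith A x`: a query `true :: q` is in it
iff `q ∈ A`, a query `false :: q` (or the empty query) iff the integer affine form coded by `q` is
`≥ 0` at `x`. [cite: FournierKoiran2000, §2 (after Thm 2: the oracle tape receives words of `{0,1}*`)] -/
def tagLang (A : Language Bool) {n : ℕ} (x : Fin n → ℝ) : Language Bool :=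
  {qry | (qry.headD false = true ∧ qry.tail ∈ A) ∨
    (qry.headD false = false ∧ (0 : ℝ) ≤ affineQueryValue x qry.tail)}

variable {n : ℕ}

/-- `true :: q ∈ tagLang A x ↔ q ∈ A`. [folklore] -/
@[simp] theorem true_cons_mem_tagLang (A : Language Bool) (x : Fin n → ℝ) (q : List Bool) :
    (true :: q) ∈ tagLang A x ↔ q ∈ A := by
  change (true = true ∧ q ∈ A) ∨ (true = false ∧ (0 : ℝ) ≤ affineQueryValue x q) ↔ _
  simp

/-- `false :: q ∈ tagLang A x ↔ 0 ≤ form_q(x)`. [folklore] -/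
@[simp] theorem false_cons_mem_tagLang (A : Language Bool) (x : Fin n → ℝ) (q : List Bool) :
    (false :: q) ∈ tagLang A x ↔ (0 : ℝ) ≤ affineQueryValue x q := by
  change (false = true ∧ q ∈ A) ∨ (false = false ∧ (0 : ℝ) ≤ affineQueryValue x q) ↔ _
  simp

/-- `[] ∈ tagLang A x ↔ 0 ≤ form_ε(x)` (the empty query goes to the sign oracle). [folklore] -/
theorem nil_mem_tagLang (A : Language Bool) (x : Fin n → ℝ) :
    ([] : List Bool) ∈ tagLang A x ↔ (0 : ℝ) ≤ affineQueryValue x [] := by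
  change (false = true ∧ ([] : List Bool) ∈ A) ∨ (false = false ∧ (0 : ℝ) ≤ affineQueryValue x []) ↔ _
  simp

/-- The indicator of a language is `decide` of any equivalent decidable proposition. [folklore] -/
private theorem boolIndicator_eq_decide (A : Language Bool) (w : List Bool) {p : Prop} [Decidable p]
    (hp : w ∈ A ↔ p) : A.boolIndicator w = decide p := by
  by_cases h : w ∈ A
  · rw [(Set.mem_iff_boolIndicator _ _).1 h, decide_eq_true (hp.1 h)]
  · rw [(Set.notMem_iff_boolIndicator _ _).1 h, decide_eq_false (fun h' => h (hp.2 h'))]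

/-- The indicator of `tagLang` on a driver query. [folklore] -/
theorem boolIndicator_tagLang_true_cons (A : Language Bool) (x : Fin n → ℝ) (q : List Bool) :
    (tagLang A x).boolIndicator (true :: q) = A.boolIndicator q := by
  by_cases h : q ∈ A
  · rw [(Set.mem_iff_boolIndicator _ _).1 h,
      (Set.mem_iff_boolIndicator _ _).1 ((true_cons_mem_tagLang A x q).2 h)]
  · rw [(Set.notMem_iff_boolIndicator _ _).1 h,
      (Set.notMem_iff_boolIndicator _ _).1 (fun h' => h ((true_cons_mem_tagLang A x q).1 h'))]

/-- The indicator of `tagLang` on a sign query. [folklore] -/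
theorem boolIndicator_tagLang_false_cons (A : Language Bool) (x : Fin n → ℝ) (q : List Bool) :
    (tagLang A x).boolIndicator (false :: q) = decide ((0 : ℝ) ≤ affineQueryValue x q) :=
  boolIndicator_eq_decide _ _ (false_cons_mem_tagLang A x q)

/-- The indicator of `tagLang` on the empty query. [folklore] -/
theorem boolIndicator_tagLang_nil (A : Language Bool) (x : Fin n → ℝ) :
    (tagLang A x).boolIndicator [] = decide ((0 : ℝ) ≤ affineQueryValue x []) :=
  boolIndicator_eq_decide _ _ (nil_mem_tagLang A x)

/-- **The tagged oracle is the language oracle of `tagLang A x`.**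
[cite: FournierKoiran2000, §2 (after Thm 2)] -/
theorem signOracleWith_eq_ofLanguage (A : Language Bool) (x : Fin n → ℝ) :
    signOracleWith A x = Oracle.ofLanguage (tagLang A x) := by
  funext qry
  rw [Oracle.ofLanguage_apply]
  rcases qry with _ | ⟨b, q⟩
  · change signOracle x [] = _
    rw [signOracle_apply, boolIndicator_tagLang_nil]
  · cases b
    · rw [signOracleWith_false_cons, signOracle_apply, boolIndicator_tagLang_false_cons]
    · rw [signOracleWith_true_cons, boolIndicator_tagLang_true_cons,
        @boolIndicator_eq_decide A q (q ∈ A) (Classical.dec _) Iff.rfl]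

/-- Length of a unary numeral. [folklore] -/
private theorem length_unaryEncodeNat (k : ℕ) : (unaryEncodeNat k).length = k := by
  induction k with
  | zero => rfl
  | succ k ih => rw [unaryEncodeNat, List.length_cons, ih]

/-- Unary numerals are blocks of ones. [folklore] -/
private theorem unaryEncodeNat_eq_ones (k : ℕ) : unaryEncodeNat k = ones k := by
  induction k with
  | zero => rfl
  | succ k ih => rw [unaryEncodeNat, ih]; rfl

/-! ### From bounded adaptive reductions to `P⁰_ℝovs(A)` -/

/-- **Adaptive reductions decide real languages relative to a Boolean oracle.** If `Q ∈ FP`,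
`D ∈ P`, and for every dimension `n` and point `x` the reduced language of the adaptive reduction
`(Q, q, D)` to `tagLang A x` contains `1ⁿ` exactly when `x ∈ L n`, then `L ∈ PAddRel A`
(machine `adAlg Q q D`, round budget `q + 1`). [cite: LadnerLynchSelman1975, §2] -/
theorem mem_PAddRel_of_adLang {Q : List Bool → List Bool} {q : Polynomial ℕ} {D : Language Bool}
    (hQ : Q ∈ FP) (hD : D ∈ Classes.P) {A : Language Bool} {L : RealLanguage}
    (h : ∀ (n : ℕ) (x : Fin n → ℝ), unaryEncodeNat n ∈ adLang Q q D (tagLang A x) ↔ x ∈ L n) :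
    L ∈ PAddRel A := by
  refine ⟨adAlg Q q D, isPolyTime_adAlg hQ hD, q + 1, fun n x => ?_⟩
  rw [signOracleWith_eq_ofLanguage, run_adAlg (tagLang A x) (unaryEncodeNat n)
    (by rw [eval_add, eval_one, length_unaryEncodeNat]; exact Nat.lt_succ_self _)]
  congr 1
  by_cases hx : x ∈ L n
  · rw [(Set.mem_iff_boolIndicator _ _).1 ((h n x).2 hx), @decide_eq_true _ (Classical.dec _) hx]
  · rw [(Set.notMem_iff_boolIndicator _ _).1 (fun h' => hx ((h n x).1 h')),
      @decide_eq_false _ (Classical.dec _) hx]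

/-! ### The driven machine: query generator and verdict -/

section Machine

variable (m P T : Polynomial ℕ)

/-- The one-bit test "this is a sign round": on `⟨1ⁿ, bits⟩`, `[|bits| < T(n) ∧ P(n) ∣ |bits| + 1]`.
[folklore] -/
noncomputable def signRoundC : List Bool → List Bool :=
  andFn (notFn (eqPairFn ∘ fanoutFn (Plumb.dropFn ∘ fanoutFn sndF (Plumb.polyFn T ∘ fstF)) (fun _ => [])))
    (eqPairFn ∘ fanoutFn (Plumb.modLenFn ∘ fanoutFn (Plumb.polyFn P ∘ fstF) (List.cons true ∘ sndF))
      (fun _ => []))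

/-- The payload of a sign round: on `⟨1ⁿ, bits⟩`, the last `m(n)` bits `bits ⇂ (|bits| - m(n))`.
[folklore] -/
noncomputable def payloadF : List Bool → List Bool :=
  Plumb.dropFn ∘ fanoutFn (Plumb.dropFn ∘ fanoutFn (Plumb.polyFn m ∘ fstF) (onesFn ∘ sndF)) sndF

/-- **The query generator of the driven sign machine**: in a sign round ask the sign oracle the
payload (`false :: payload`), otherwise ask the Boolean oracle the whole transcript
(`true :: ⟨1ⁿ, bits⟩`). [cite: FournierKoiran2000, §2 (p. 4: the oracle model)] -/
noncomputable def drvQ : List Bool → List Bool :=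
  iteFn (signRoundC P T) (List.cons false ∘ payloadF m) (List.cons true)

variable {m P T}

/-- `ones a = [] ↔ a = 0`. [folklore] -/
private theorem ones_eq_nil_iff' (a : ℕ) : ones a = [] ↔ a = 0 := by
  simp [ones, List.replicate_eq_nil_iff]

/-- Value of the sign-round test. [folklore] -/
theorem signRoundC_apply (n : ℕ) (bits : List Bool) :
    signRoundC P T (boolPair (unaryEncodeNat n) bits) =
      [decide (bits.length < T.eval n) && decide ((bits.length + 1) % P.eval n = 0)] := by
  have h1 : (eqPairFn ∘ fanoutFn (Plumb.dropFn ∘ fanoutFn sndF (Plumb.polyFn T ∘ fstF)) (fun _ => []))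
      (boolPair (unaryEncodeNat n) bits) = [decide (T.eval n ≤ bits.length)] := by
    simp only [Function.comp_apply, fanoutFn_apply, sndF_boolPair, fstF_boolPair, Plumb.polyFn_apply,
      length_unaryEncodeNat, Plumb.dropFn_boolPair, eqPairFn_boolPair]
    congr 1
    apply Bool.decide_congr
    simp [ones, List.replicate_eq_nil_iff, Nat.sub_eq_zero_iff_le]
  have h2 : (eqPairFn ∘ fanoutFn (Plumb.modLenFn ∘ fanoutFn (Plumb.polyFn P ∘ fstF) (List.cons true ∘ sndF))
      (fun _ => [])) (boolPair (unaryEncodeNat n) bits) = [decide ((bits.length + 1) % P.eval n = 0)] := by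
    simp only [Function.comp_apply, fanoutFn_apply, sndF_boolPair, fstF_boolPair, Plumb.polyFn_apply,
      length_unaryEncodeNat, Plumb.modLenFn_boolPair, eqPairFn_boolPair, List.length_cons, ones_eq_nil_iff']
  rw [signRoundC, andFn_apply (notFn_apply h1) h2]
  congr 2
  rw [← decide_not]
  exact Bool.decide_congr Nat.not_le

/-- Value of the payload extractor. [folklore] -/
theorem payloadF_apply (n : ℕ) (bits : List Bool) :
    payloadF m (boolPair (unaryEncodeNat n) bits) = bits.drop (bits.length - m.eval n) := by
  simp only [payloadF, Function.comp_apply, fanoutFn_apply, fstF_boolPair, sndF_boolPair,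
    Plumb.polyFn_apply, length_unaryEncodeNat, Plumb.dropFn_boolPair, onesFn]
  rw [unaryEncodeNat_eq_ones, show (ones bits.length).drop (ones (m.eval n)).length =
    ones (bits.length - m.eval n) by simp [ones, List.drop_replicate]]
  simp [ones]

/-- **Value of the query generator** on a transcript `⟨1ⁿ, bits⟩`. [folklore] -/
theorem drvQ_apply (n : ℕ) (bits : List Bool) :
    drvQ m P T (boolPair (unaryEncodeNat n) bits) =
      if bits.length < T.eval n ∧ (bits.length + 1) % P.eval n = 0 then
        false :: bits.drop (bits.length - m.eval n)
      else true :: boolPair (unaryEncodeNat n) bits := by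
  rw [drvQ, iteFn_apply (signRoundC_apply n bits)]
  simp only [Function.comp_apply, payloadF_apply, Bool.and_eq_true, decide_eq_true_eq]

/-- **The query generator is polynomial-time.** [cite: AroraBarak2009, §1.3 (closure of polynomial time under composition)] -/
theorem drvQ_mem_FP : drvQ m P T ∈ FP := by
  refine iteFn_mem_FP ?_ (comp_mem_FP (cons_mem_FP false) ?_) (cons_mem_FP true)
  · refine andFn_mem_FP (notFn_mem_FP (comp_mem_FP eqPairFn_mem_FP (fanoutFn_mem_FP
      (comp_mem_FP Plumb.dropFn_mem_FP (fanoutFn_mem_FP sndF_mem_FP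
        (comp_mem_FP (Plumb.polyFn_mem_FP T) fstF_mem_FP))) (const_mem_FP _)))) ?_
    exact comp_mem_FP eqPairFn_mem_FP (fanoutFn_mem_FP (comp_mem_FP Plumb.modLenFn_mem_FP
      (fanoutFn_mem_FP (comp_mem_FP (Plumb.polyFn_mem_FP P) fstF_mem_FP)
        (comp_mem_FP (cons_mem_FP true) sndF_mem_FP))) (const_mem_FP _))
  · exact comp_mem_FP Plumb.dropFn_mem_FP (fanoutFn_mem_FP (comp_mem_FP Plumb.dropFn_mem_FP
      (fanoutFn_mem_FP (comp_mem_FP (Plumb.polyFn_mem_FP m) fstF_mem_FP)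
        (comp_mem_FP onesFn_mem_FP sndF_mem_FP))) sndF_mem_FP)

/-- Membership of a transcript in the verdict language `BrainProtocol.Verdict` ("the last answer
bit is `1`"). [folklore] -/
theorem boolPair_append_singleton_mem_Verdict (u bits : List Bool) (b : Bool) :
    boolPair u (bits ++ [b]) ∈ BrainProtocol.Verdict ↔ b = true := by
  change sndP (boolPair u (bits ++ [b])) ∈ BrainProtocol.LastTrue ↔ _
  rw [sndP_boolPair]
  exact BrainProtocol.append_singleton_mem_LastTrue bits b

variable (m P T)

/-- **The driven sign machine** `drvAlg m P T`: the adaptive oracle algorithm with query generator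
`drvQ m P T`, exactly `T + 1` queries, and verdict `BrainProtocol.Verdict` — the last answer bit
(so it is run with round budget `T + 2`).
[cite: FournierKoiran2000, §2 (p. 4: the oracle model)] -/
noncomputable abbrev drvAlg : OracleAlg Bool :=
  adAlg (drvQ m P T) (T + 1) BrainProtocol.Verdict

/-- **The driven sign machine is polynomial-time** (an instance of `isPolyTime_adAlg`): its step
function is polynomial-time computable whatever the three parameters.
[cite: FournierKoiran2000, §2 (p. 4: "tedious but completely straightforward")] -/
theorem isPolyTime_drvAlg : (drvAlg m P T).IsPolyTime encodingBoolBool :=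
  isPolyTime_adAlg drvQ_mem_FP BrainProtocol.Verdict_mem_P

end Machine

end FKTransfer

end Literature.Computability.Complexity

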